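import Mathlib
import Summits.Ventures.PercRepro2.Defs
import Summits.Ventures.PercRepro2.Independence
import Summits.Ventures.PercRepro2.Graph
import Summits.Ventures.PercRepro2.Exploration
import Summits.Ventures.PercRepro2.Induced
import Summits.Ventures.PercRepro2.R2PrimeThreeReduction
import Summits.Ventures.PercRepro2.YBridge
import Summits.Ventures.PercRepro2.HCov
import Summits.Ventures.PercRepro2.HCovFns
import Summits.Ventures.PercRepro2.HCovCubic
import Summits.Ventures.PercRepro2.TriDisagreement
import Summits.Ventures.PercRepro2.TriDisagreementPinned
import Summits.Ventures.PercRepro2.DAD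
import Summits.Ventures.PercRepro2.HubModel
import Summits.Ventures.PercRepro2.HubLaw
import Summits.Ventures.PercRepro2.HubRootLaw
import Summits.Ventures.PercRepro2.HubConn
import Summits.Ventures.PercRepro2.HubBernstein
import Summits.Ventures.PercRepro2.HubGc
import Summits.Ventures.PercRepro2.HubKron
import Summits.Ventures.PercRepro2.HubCert
import Summits.Ventures.PercRepro2.HubHarris
import Summits.Ventures.PercRepro2.HubKernelP1
import Summits.Ventures.PercRepro2.HubTyped

/-!
# Fibre Harris for the inner count tensor
(blind cell PercRepro2, typer-1 g8; NIGHT3-CERT.md §11 (v), the typed R theorem, part T3a)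

For a fixed third copy `w` the typed pairs `(x, y)` with `(x, y, w) ∈ tset FI z τ` form the DAD
fibre: `x = cfg (Z ∪ r)`, `y = cfg (Z ∪ (A ∖ r))` for `r ⊆ A`, where `A = Aset` (the typed inner
edges with `τ_e − w_e = 1`) and `Z = Zset` (the edges forced open) — `typed_iff_fibre`,
`sum_typed_fibre`.  Up-set pattern events are increasing (`isUpperSet_patFinset`), so
`DAD.fibreHarris` gives, summed over `w`, the **block inequality** of the certificates on the
inner count tensor (`block_nonneg`):

`0 ≤ Σ_{a b} Aq u v a b · Ninner (a, b, j)` for every two up-sets `u, v` and atom `j`.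
-/

namespace Summit.Ventures.PercRepro2.Hub

open Classical

section Cfg

variable {E : Type*} [Fintype E] [DecidableEq E]

/-- The configuration with the given open edges. -/
def cfg (X : Finset E) : Config E := fun e => decide (e ∈ X)

/-- The open edges of a configuration. -/
def opn (x : Config E) : Finset E := Finset.univ.filter fun e => x e = true

omit [Fintype E] in
/-- The value of `cfg`. -/
lemma cfg_apply (X : Finset E) (e : E) : cfg X e = decide (e ∈ X) := rfl

omit [DecidableEq E] in
/-- Membership in the open edges. -/
lemma mem_opn {x : Config E} {e : E} : e ∈ opn x ↔ x e = true := by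
  simp [opn]

omit [Fintype E] in
/-- `cfg` is monotone. -/
lemma cfg_mono {X Y : Finset E} (h : X ⊆ Y) : cfg X ≤ cfg Y := by
  intro e
  by_cases hx : e ∈ X
  · simp [cfg, hx, h hx]
  · simp [cfg, hx]

end Cfg

section Fibre

variable {V : Type*} {E : Type*} [Fintype E] [DecidableEq E] {ends : E → Sym2 V} {μ : Mark → V}

/-- The typed inner edges with `τ_e = w_e + 1`: exactly one of the two other copies is open. -/
def Aset (FI : Finset E) (τ : E → ℕ) (w : Config E) : Finset E :=
  FI.filter fun e => τ e = (w e).toNat + 1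

/-- The edges forced open in both other copies: the pinned open edges and those with
`τ_e = w_e + 2`. -/
def Zset (FI : Finset E) (z : Config E) (τ : E → ℕ) (w : Config E) : Finset E :=
  (Finset.univ.filter fun e => e ∉ FI ∧ z e = true) ∪ FI.filter fun e => τ e = (w e).toNat + 2

/-- The forced edges and the free edges are disjoint. -/
lemma disjoint_Zset_Aset (FI : Finset E) (z : Config E) (τ : E → ℕ) (w : Config E) :
    Disjoint (Zset FI z τ w) (Aset FI τ w) := by
  rw [Finset.disjoint_left]
  intro e hZ hA
  simp only [Zset, Aset, Finset.mem_union, Finset.mem_filter, Finset.mem_univ, true_and] at hZ hA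
  rcases hZ with hZ | hZ
  · exact hZ.1 hA.1
  · omega

/-- The first copy of the fibre element `r`. -/
def xOf (FI : Finset E) (z : Config E) (τ : E → ℕ) (w : Config E) (r : Finset E) : Config E :=
  cfg (Zset FI z τ w ∪ r)

/-- The second copy of the fibre element `r`. -/
def yOf (FI : Finset E) (z : Config E) (τ : E → ℕ) (w : Config E) (r : Finset E) : Config E :=
  cfg (Zset FI z τ w ∪ (Aset FI τ w \ r))

/-- The fibre parameter of a typed pair. -/
def rOf (FI : Finset E) (τ : E → ℕ) (w : Config E) (x : Config E) : Finset E :=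
  opn x ∩ Aset FI τ w

/-- The typed pairs over `w`. -/
noncomputable def pairSet (FI : Finset E) (z : Config E) (τ : E → ℕ) (w : Config E) :
    Finset (Config E × Config E) :=
  Finset.univ.filter fun p => Typed FI z τ (p.1, p.2, w)

variable (FI : Finset E) (z : Config E) (τ : E → ℕ) (w : Config E)
  (hτ : ∀ e ∈ FI, τ e = 1 ∨ τ e = 2) (hw : ∀ e, e ∉ FI → w e = z e)
include hτ hw

/-- A fibre element gives a typed pair. -/
lemma typed_of_fibre {r : Finset E} (hr : r ⊆ Aset FI τ w) :
    Typed FI z τ (xOf FI z τ w r, yOf FI z τ w r, w) := by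
  constructor
  · intro e he
    have hwz : w e = z e := hw e he
    have hrA : e ∉ r := fun h => he (Finset.mem_filter.1 (hr h)).1
    have hZ : e ∈ Zset FI z τ w ↔ z e = true := by simp [Zset, he]
    have hA : e ∉ Aset FI τ w := fun h => he (Finset.mem_filter.1 h).1
    simp only [xOf, yOf, cfg, Finset.mem_union, Finset.mem_sdiff, hZ, hrA, hA, hwz,
      or_false, false_and]
    constructor <;> cases z e <;> simp
  · intro e he
    have hτe := hτ e he
    have hZiff : e ∈ Zset FI z τ w ↔ τ e = (w e).toNat + 2 := by simp [Zset, he]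
    have hAiff : e ∈ Aset FI τ w ↔ τ e = (w e).toNat + 1 := by simp [Aset, he]
    have hrA : e ∈ r → τ e = (w e).toNat + 1 := fun h => hAiff.1 (hr h)
    show (xOf FI z τ w r e).toNat + (yOf FI z τ w r e).toNat + (w e).toNat = τ e
    have hwb : (w e).toNat ≤ 1 := Bool.toNat_le _
    by_cases hZ : e ∈ Zset FI z τ w
    · have h2 := hZiff.1 hZ
      have hx : xOf FI z τ w r e = true := by simp [xOf, cfg, hZ]
      have hy : yOf FI z τ w r e = true := by simp [yOf, cfg, hZ]
      rw [hx, hy]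
      simp only [Bool.toNat_true]
      omega
    · by_cases hA : e ∈ Aset FI τ w
      · have h1 := hAiff.1 hA
        by_cases hr' : e ∈ r
        · have hx : xOf FI z τ w r e = true := by simp [xOf, cfg, hr']
          have hy : yOf FI z τ w r e = false := by simp [yOf, cfg, hZ, hr']
          rw [hx, hy]
          simp only [Bool.toNat_true, Bool.toNat_false]
          omega
        · have hx : xOf FI z τ w r e = false := by simp [xOf, cfg, hZ, hr']
          have hy : yOf FI z τ w r e = true := by simp [yOf, cfg, hA, hr']
          rw [hx, hy]
          simp only [Bool.toNat_true, Bool.toNat_false]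
          omega
      · have hr' : e ∉ r := fun h => hA (hr h)
        have hx : xOf FI z τ w r e = false := by simp [xOf, cfg, hZ, hr']
        have hy : yOf FI z τ w r e = false := by simp [yOf, cfg, hZ, hA]
        have h1 : ¬ τ e = (w e).toNat + 1 := fun h => hA (hAiff.2 h)
        have h2 : ¬ τ e = (w e).toNat + 2 := fun h => hZ (hZiff.2 h)
        rw [hx, hy]
        simp only [Bool.toNat_false]
        rcases hτe with h | h <;> omega

omit hw in
/-- The first copy of a typed pair is recovered from its fibre parameter. -/
lemma xOf_rOf {x y : Config E} (h : Typed FI z τ (x, y, w)) : xOf FI z τ w (rOf FI τ w x) = x := by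
  obtain ⟨hpin, hcount⟩ := h
  funext e
  by_cases he : e ∈ FI
  · have hc : (x e).toNat + (y e).toNat + (w e).toNat = τ e := hcount e he
    have hτe := hτ e he
    have hZiff : e ∈ Zset FI z τ w ↔ τ e = (w e).toNat + 2 := by simp [Zset, he]
    have hAiff : e ∈ Aset FI τ w ↔ τ e = (w e).toNat + 1 := by simp [Aset, he]
    simp only [xOf, rOf, cfg, Finset.mem_union, Finset.mem_inter, mem_opn, hZiff, hAiff]
    rcases hτe with h | h <;> cases hx : x e <;> cases hy : y e <;> cases hwe : w e <;>
      simp_all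
  · have hx : x e = z e := (hpin e he).1
    have hZ : e ∈ Zset FI z τ w ↔ z e = true := by simp [Zset, he]
    have hA : e ∉ Aset FI τ w := fun h => he (Finset.mem_filter.1 h).1
    simp only [xOf, rOf, cfg, Finset.mem_union, Finset.mem_inter, hZ, hA, and_false, or_false, hx]
    cases z e <;> simp

omit hw in
/-- The second copy of a typed pair is recovered from its fibre parameter. -/
lemma yOf_rOf {x y : Config E} (h : Typed FI z τ (x, y, w)) : yOf FI z τ w (rOf FI τ w x) = y := by
  obtain ⟨hpin, hcount⟩ := h
  funext e
  by_cases he : e ∈ FI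
  · have hc : (x e).toNat + (y e).toNat + (w e).toNat = τ e := hcount e he
    have hτe := hτ e he
    have hZiff : e ∈ Zset FI z τ w ↔ τ e = (w e).toNat + 2 := by simp [Zset, he]
    have hAiff : e ∈ Aset FI τ w ↔ τ e = (w e).toNat + 1 := by simp [Aset, he]
    simp only [yOf, rOf, cfg, Finset.mem_union, Finset.mem_inter, Finset.mem_sdiff, mem_opn,
      hZiff, hAiff]
    rcases hτe with h | h <;> cases hx : x e <;> cases hy : y e <;> cases hwe : w e <;>
      simp_all
  · have hy : y e = z e := (hpin e he).2.1
    have hZ : e ∈ Zset FI z τ w ↔ z e = true := by simp [Zset, he]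
    have hA : e ∉ Aset FI τ w := fun h => he (Finset.mem_filter.1 h).1
    simp only [yOf, rOf, cfg, Finset.mem_union, Finset.mem_inter, Finset.mem_sdiff, hZ, hA,
      and_false, or_false, false_and, hy]
    cases z e <;> simp

omit hτ hw in
/-- The fibre parameter of a fibre element is the element. -/
lemma rOf_xOf {r : Finset E} (hr : r ⊆ Aset FI τ w) : rOf FI τ w (xOf FI z τ w r) = r := by
  ext e
  simp only [rOf, xOf, cfg, Finset.mem_inter, mem_opn, decide_eq_true_eq, Finset.mem_union]
  constructor
  · rintro ⟨hZr, hA⟩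
    rcases hZr with hZ | hr'
    · exact absurd hA (Finset.disjoint_left.1 (disjoint_Zset_Aset FI z τ w) hZ)
    · exact hr'
  · intro hr'
    exact ⟨Or.inr hr', hr hr'⟩

/-- **The typed pairs over `w` are the DAD fibre**: a sum over the typed pairs is a sum over the
subsets of `Aset`. -/
theorem sum_typed_fibre {S : Type*} [AddCommMonoid S] (G : Config E → Config E → S) :
    ∑ p ∈ pairSet FI z τ w, G p.1 p.2 =
      ∑ r ∈ (Aset FI τ w).powerset, G (xOf FI z τ w r) (yOf FI z τ w r) := by
  refine Finset.sum_nbij' (fun p => rOf FI τ w p.1) (fun r => (xOf FI z τ w r, yOf FI z τ w r))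
    ?_ ?_ ?_ ?_ ?_
  · intro p _
    exact Finset.mem_powerset.2 Finset.inter_subset_right
  · intro r hr
    exact Finset.mem_filter.2 ⟨Finset.mem_univ _, typed_of_fibre FI z τ w hτ hw
      (Finset.mem_powerset.1 hr)⟩
  · intro p hp
    have h := (Finset.mem_filter.1 hp).2
    exact Prod.ext (xOf_rOf FI z τ w hτ h) (yOf_rOf FI z τ w hτ h)
  · intro r hr
    exact rOf_xOf FI z τ w (Finset.mem_powerset.1 hr)
  · intro p hp
    have h := (Finset.mem_filter.1 hp).2
    rw [xOf_rOf FI z τ w hτ h, yOf_rOf FI z τ w hτ h]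

end Fibre

section Harris

variable {V : Type*} {E : Type*} [Fintype E] [DecidableEq E] {ends : E → Sym2 V} {μ : Mark → V}
  {S : Type*} [Field S] [LinearOrder S] [IsStrictOrderedRing S]

omit [Fintype E] in
/-- The pattern event of a monotone predicate, as a set of edge sets, is an up-set. -/
lemma isUpperSet_patFinset (U : (Fin 3 → Bool) → Bool)
    (hU : ∀ π π', (∀ i, π i = true → π' i = true) → U π = true → U π' = true) :
    IsUpperSet {X : Finset E | U (innerPat ends μ (cfg X)) = true} := by
  intro X Y hXY hX
  exact hU _ _ (fun i hi => innerPat_mono (cfg_mono hXY) i hi) hX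

omit [Fintype E] [LinearOrder S] [IsStrictOrderedRing S] in
/-- The indicator of an up-set pattern event at an edge set, as an `if`. -/
lemma indicator_patFinset (U : (Fin 3 → Bool) → Bool) (X : Finset E) :
    ({X : Finset E | U (innerPat ends μ (cfg X)) = true}).indicator (1 : Finset E → S) X =
      if U (innerPat ends μ (cfg X)) then 1 else 0 := by
  rw [Set.indicator_apply]
  simp only [Set.mem_setOf_eq, Pi.one_apply]

/-- **Fibre Harris on one fibre**: over the typed pairs of `w`, the count of `x ∈ U_u ∩ U_v`
dominates the count of `x ∈ U_u, y ∈ U_v`. -/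
theorem fibre_block (FI : Finset E) (z : Config E) (τ : E → ℕ) (w : Config E)
    (hτ : ∀ e ∈ FI, τ e = 1 ∨ τ e = 2) (hw : ∀ e, e ∉ FI → w e = z e) (u v : Fin 8) :
    ∑ p ∈ pairSet FI z τ w,
        ((if upPat u (innerPat ends μ p.1) then 1 else 0) : S) *
          (if upPat v (innerPat ends μ p.2) then 1 else 0) ≤
      ∑ p ∈ pairSet FI z τ w,
        ((if upPat u (innerPat ends μ p.1) && upPat v (innerPat ends μ p.1) then 1 else 0) : S) := by
  rw [sum_typed_fibre FI z τ w hτ hw (fun x y => ((if upPat u (innerPat ends μ x) then 1 else 0) : S)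
    * (if upPat v (innerPat ends μ y) then 1 else 0)),
    sum_typed_fibre FI z τ w hτ hw (fun x _ =>
      ((if upPat u (innerPat ends μ x) && upPat v (innerPat ends μ x) then 1 else 0) : S))]
  have h := DAD.fibreHarris (R := S) (Aset FI τ w) (Zset FI z τ w) (Zset FI z τ w)
    (disjoint_Zset_Aset FI z τ w) (disjoint_Zset_Aset FI z τ w)
    {X : Finset E | upPat u (innerPat ends μ (cfg X)) = true}
    {X : Finset E | upPat v (innerPat ends μ (cfg X)) = true}
    (isUpperSet_patFinset (upPat u) (upPat_mono u)) (isUpperSet_patFinset (upPat v) (upPat_mono v))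
  simp only [indicator_patFinset, Finset.union_self] at h
  refine le_trans (le_of_eq ?_) (h.trans (le_of_eq ?_))
  · rfl
  · refine Finset.sum_congr rfl fun r _ => ?_
    rw [Set.indicator_apply]
    simp only [Set.mem_inter_iff, Set.mem_setOf_eq, Pi.one_apply, xOf, Bool.and_eq_true]

end Harris

section Block

variable {V : Type*} {E : Type*} [Fintype E] [DecidableEq E] {ends : E → Sym2 V} {μ : Mark → V}
  {S : Type*} [Field S] [LinearOrder S] [IsStrictOrderedRing S]

/-- The indicator of an up-set at a pattern. -/
def iuP (u : Fin 8) (π : Fin 3 → Bool) : S := if upPat u π then 1 else 0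

omit [LinearOrder S] [IsStrictOrderedRing S] in
/-- The typed inner triple set regrouped by the third copy. -/
lemma sum_tset_third (FI : Finset E) (z : Config E) (τ : E → ℕ) (G : Triple E → S) :
    ∑ t ∈ tset FI z τ, G t = ∑ w : Config E, ∑ p ∈ pairSet FI z τ w, G (p.1, p.2, w) := by
  unfold tset pairSet
  simp only [Finset.sum_filter, Fintype.sum_prod_type]
  exact (Finset.sum_congr rfl fun x _ => Finset.sum_comm).trans Finset.sum_comm

omit [Fintype E] [DecidableEq E] in
/-- The third copy of a typed triple is pinned off the typed edges. -/
lemma third_pinned {FI : Finset E} {z : Config E} {τ : E → ℕ} {t : Triple E}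
    (ht : Typed FI z τ t) : ∀ e, e ∉ FI → t.2.2 e = z e := fun e he => (ht.1 e he).2.2

/-- **The block inequality on the inner triples**: for two up-sets and a predicate on the third
copy, the typed triples with `x ∈ U_u ∩ U_v` outnumber those with `x ∈ U_u, y ∈ U_v`. -/
theorem block_nonneg_tset (FI : Finset E) (z : Config E) (τ : E → ℕ)
    (hτ : ∀ e ∈ FI, τ e = 1 ∨ τ e = 2) (u v : Fin 8) (Q : Config E → Prop) :
    0 ≤ ∑ t ∈ tset FI z τ, (if Q t.2.2 then 1 else 0 : S) *
      (iuP u (innerPat ends μ t.1) * iuP v (innerPat ends μ t.1) -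
        iuP u (innerPat ends μ t.1) * iuP v (innerPat ends μ t.2.1)) := by
  rw [sum_tset_third]
  refine Finset.sum_nonneg fun w _ => ?_
  by_cases hQ : Q w
  · simp only [hQ, if_true, one_mul]
    rw [Finset.sum_sub_distrib, sub_nonneg]
    by_cases hw : ∀ e, e ∉ FI → w e = z e
    · have h := fibre_block (ends := ends) (μ := μ) (S := S) FI z τ w hτ hw u v
      refine le_trans (le_of_eq ?_) (h.trans (le_of_eq ?_))
      · refine Finset.sum_congr rfl fun p _ => ?_
        simp only [iuP]
      · refine Finset.sum_congr rfl fun p _ => ?_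
        simp only [iuP]
        cases upPat u (innerPat ends μ p.1) <;> cases upPat v (innerPat ends μ p.1) <;> simp
    · have hempty : pairSet FI z τ w = ∅ := by
        rw [Finset.eq_empty_iff_forall_notMem]
        intro p hp
        exact hw (third_pinned (Finset.mem_filter.1 hp).2)
      simp [hempty]
  · simp [hQ]

end Block

end Summit.Ventures.PercRepro2.Hub
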